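import Summits.AtomisticToContinuum.Crystallization.Theses.GappedShellCensus
import Summits.AtomisticToContinuum.Crystallization.Theorems.TwelveWithinOne.Negative.LoadBearingAndSharpness
import Literature.Geometry.DiscreteGeometry.TammesThirteen

/-!
# `GappedShellCensus.RadialDefectsVanish` (stmt-AtomisticToContinuum-15930) — the SPLIT glue, landed, and the
# geometric child modulo Tammes-13

Route `GappedShellCensus`, crux `RadialDefectsVanish` (rank 3), SPLIT (gen 1, route file rev ≥ 5, 2026-08-17) into
`TwelveWithinOne` (= `SquareWellLayerCake.TwelveWithinOne`, stmt-AtomisticToContinuum-15808, verbatim), `ThickThirteen`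
(theorem-grade geometry) and `GapBeyondTwelve` (new crux), with glue `RadialDefectsVanishGlue`.  This file is the
prover-landed copy (line `Sketch` rev 3 of the crux chain, lead c2) of the crux-strategist's kernel-checked glue
`Cruxes/RadialDefectsVanish/SplitGlue.lean` (commit 4c8ccb626e41) — the three lemmas of `namespace RdvSplit` and
`RadialDefectsVanish_of_subs` are VERBATIM that file (hypotheses stated LITERALLY, so the theorem elaborates whatever the
ledger names the children) — plus the one child that is provable today modulo a named fact:

* `RdvSplit.stub_thickThirteen_of_tammes` : `musinTarasov2012_tammes_thirteen → ThickThirteen` (stated literally): points of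
  `ℝ³` with norms in `[55/57, 1]` and mutual distances `≥ 55/57` radially project to unit vectors with pairwise inner product
  `≤ 1 − (55/57)²/2` (`TwelveWithinOne.Negative.inner_normalized_le`, landed), i.e. chord `≥ 55/57 = 0.9649 > 0.957`, the
  threshold of the tree's Tammes-13 named fact (Musin–Tarasov 2012, Thm 1: `δ₁₃ = 57.1367°`; here `57.69°`); the projection is
  injective on such a set, so at most twelve points.  CONDITIONAL on that fact (undischarged in tree: pure Delsarte LP stops at
  `13.1`, Bachoc–Vallentin SDP at `58.5°`; the tree programme `Literature/Geometry/DiscreteGeometry/SphericalCode*` works on it).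
* `radialDefectsVanish_of_tammes` : the crux from the Tammes-13 fact and the two ENERGETIC children only
  (`TwelveWithinOne`, `GapBeyondTwelve`, stated literally) — the honest dependency of the split: one named fact of discrete
  geometry and two statements about true Lennard-Jones ground states (both open-problem grade: Blanc–Lewin 2015 §2.3).

Glue (strategist D5, STRATEGY-CENSUS.md): `ThickThirteen` upgrades "≥ 12 within 1" to "exactly 12 within 1" pointwise
(`card_bond_le_twelve`); a locally-twelve site with no annulus neighbour is gapped-twelve at the SELECTED scale `a = 50/51`
(`gappedTwelve_of_twelve`: bond window `[49/51, 1] ⊇ [55/57, 1]`, gap `(1, 21/17) = (1.02a, 1.26a)`); sites that are not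
locally twelve lie within `7/2` of a non-twelve site, at most `(7/δ₀ + 1)³` of them per non-twelve site by the `δ₀`-separation of
ground states (`LennardJonesMinimalDistance_holds`) and the packing count `card_le_of_separated_of_dist_le`
(`card_le_mul_card_of_local`); `Tendsto`/`Frequently` bookkeeping finishes.  The ground-state hypothesis is spent inside the
two energetic children and on `δ₀` (cf. `RadialDefectsVanish.Negative.radialDefectsVanish_false_without_GS`).  The scale is a
genuine selection (`RadialDefectsVanish.Negative.ScaleLock`: the `∀ a ∈ [47/50,1]` strengthening is false).
-/

noncomputable section

open scoped BigOperators Topology Classical RealInnerProductSpace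
open Filter Finset
open Literature.MathematicalPhysics.StatisticalMechanics
open Literature.Geometry.DiscreteGeometry (musinTarasov2012_tammes_thirteen)

namespace Summit.AtomisticToContinuum.Crystallization.Theorems

namespace RdvSplit

variable {N : ℕ}

/-- **Thick thirteen ⇒ at most twelve bonds.**  If every site within `11/10` of `X i` is
`55/57`-separated from all other sites and no thirteen points of `ℝ³` with norms in `[55/57, 1]` are
pairwise `≥ 55/57` apart, then at most twelve other sites lie within distance `1` of `X i` (translate the
bond set to the origin). [folklore] -/
theorem card_bond_le_twelve
    (hT : ∀ T : Finset (EuclideanSpace ℝ (Fin 3)), (∀ v ∈ T, (55 : ℝ) / 57 ≤ ‖v‖ ∧ ‖v‖ ≤ 1) →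
      (∀ v ∈ T, ∀ w ∈ T, v ≠ w → (55 : ℝ) / 57 ≤ dist v w) → T.card ≤ 12)
    (X : Fin N → EuclideanSpace ℝ (Fin 3)) {i : Fin N}
    (hNb : ∀ j : Fin N, dist (X i) (X j) ≤ 11 / 10 → ∀ k : Fin N, k ≠ j → (55 : ℝ) / 57 ≤ dist (X j) (X k)) :
    (Finset.univ.filter fun j : Fin N => j ≠ i ∧ dist (X i) (X j) ≤ 1).card ≤ 12 := by
  set S := Finset.univ.filter fun j : Fin N => j ≠ i ∧ dist (X i) (X j) ≤ 1 with hS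
  have hSepi : ∀ k : Fin N, k ≠ i → (55 : ℝ) / 57 ≤ dist (X i) (X k) :=
    hNb i (by rw [dist_self]; norm_num)
  have hmemS : ∀ j ∈ S, j ≠ i ∧ dist (X i) (X j) ≤ 1 := fun j hj => (Finset.mem_filter.1 hj).2
  have hSepS : ∀ j ∈ S, ∀ k : Fin N, k ≠ j → (55 : ℝ) / 57 ≤ dist (X j) (X k) := fun j hj =>
    hNb j ((hmemS j hj).2.trans (by norm_num))
  have hinj : Set.InjOn (fun j => X j - X i) (S : Set (Fin N)) := by
    intro j hj j' hj' hjj'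
    by_contra hne
    have h1 : (55 : ℝ) / 57 ≤ dist (X j) (X j') := hSepS j hj j' (Ne.symm hne)
    have h2 : X j = X j' := sub_left_inj.1 hjj'
    rw [h2, dist_self] at h1
    norm_num at h1
  have hcard : (S.image fun j => X j - X i).card = S.card := Finset.card_image_of_injOn hinj
  have h12 : (S.image fun j => X j - X i).card ≤ 12 := by
    refine hT _ ?_ ?_
    · intro v hv
      obtain ⟨j, hj, rfl⟩ := Finset.mem_image.1 hv
      have hji := hmemS j hj
      have hd : ‖X j - X i‖ = dist (X i) (X j) := by rw [dist_comm, dist_eq_norm]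
      rw [hd]
      exact ⟨hSepi j hji.1, hji.2⟩
    · intro v hv w hw hvw
      obtain ⟨j, hj, rfl⟩ := Finset.mem_image.1 hv
      obtain ⟨j', hj', rfl⟩ := Finset.mem_image.1 hw
      have hne : j' ≠ j := by
        rintro rfl
        exact hvw rfl
      rw [dist_sub_right]
      exact hSepS j hj j' hne
  rw [hcard] at h12
  exact h12

/-- **A twelve-site with no annulus neighbour is gapped-twelve at `a = 50/51`**: its bond set within
`50/51·(1 + 1/50) = 1` has exactly twelve members, every other site is `≥ 55/57 ≥ 49/51 = 50/51·(1 − 1/50)`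
away (own separation), and another site beyond `1` is beyond `21/17 = 50/51·(63/50)`. [folklore] -/
theorem gappedTwelve_of_twelve (X : Fin N → EuclideanSpace ℝ (Fin 3)) {i : Fin N}
    (hNb : ∀ j : Fin N, dist (X i) (X j) ≤ 11 / 10 → ∀ k : Fin N, k ≠ j → (55 : ℝ) / 57 ≤ dist (X j) (X k))
    (hA : (Finset.univ.filter fun j : Fin N => j ≠ i ∧ dist (X i) (X j) ≤ 1).card = 12)
    (hAnn : ¬ ∃ j : Fin N, j ≠ i ∧ 1 < dist (X i) (X j) ∧ dist (X i) (X j) < 21 / 17) :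
    (Finset.univ.filter fun j : Fin N => j ≠ i ∧ dist (X i) (X j) ≤ 50 / 51 * (1 + 1 / 50)).card = 12 ∧
      ∀ j : Fin N, j ≠ i → 50 / 51 * (1 - 1 / 50) ≤ dist (X i) (X j) ∧
        (dist (X i) (X j) ≤ 50 / 51 * (1 + 1 / 50) ∨ 50 / 51 * (63 / 50) ≤ dist (X i) (X j)) := by
  have hSepi : ∀ k : Fin N, k ≠ i → (55 : ℝ) / 57 ≤ dist (X i) (X k) :=
    hNb i (by rw [dist_self]; norm_num)
  have h1 : (50 : ℝ) / 51 * (1 + 1 / 50) = 1 := by norm_num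
  have h2 : (50 : ℝ) / 51 * (63 / 50) = 21 / 17 := by norm_num
  refine ⟨?_, fun j hj => ⟨?_, ?_⟩⟩
  · have hEq : (Finset.univ.filter fun j : Fin N => j ≠ i ∧ dist (X i) (X j) ≤ 50 / 51 * (1 + 1 / 50)) =
        Finset.univ.filter fun j : Fin N => j ≠ i ∧ dist (X i) (X j) ≤ 1 := by
      refine Finset.filter_congr fun j _ => ?_
      rw [h1]
    rw [hEq]
    exact hA
  · have := hSepi j hj
    have h3 : (50 : ℝ) / 51 * (1 - 1 / 50) ≤ 55 / 57 := by norm_num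
    linarith
  · by_cases hd : dist (X i) (X j) ≤ 1
    · left
      rw [h1]
      exact hd
    · right
      rw [h2]
      by_contra hlt
      push Not at hd hlt
      exact hAnn ⟨j, hj, hd, hlt⟩

/-- **Packing count of the spoiled sites** (instance-free form).  In a `δ`-separated configuration,
if every site of `SL` has, within distance `7/2`, a site violating `G`, and `SB` contains every site
violating `G`, then `#SL ≤ (2·(7/2)/δ + 1)³ · #SB`: each bad site spoils at most that many sites
(`card_le_of_separated_of_dist_le`). [folklore] -/
theorem card_le_mul_card_of_local (X : Fin N → EuclideanSpace ℝ (Fin 3)) (G : Fin N → Prop) {δ : ℝ} (hδ : 0 < δ)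
    (hsep : ∀ i j : Fin N, i ≠ j → δ ≤ dist (X i) (X j)) (SL SB : Finset (Fin N))
    (hSL : ∀ i ∈ SL, ¬ ∀ j : Fin N, dist (X i) (X j) ≤ 7 / 2 → G j) (hSB : ∀ j : Fin N, ¬ G j → j ∈ SB) :
    (SL.card : ℝ) ≤ (2 * (7 / 2) / δ + 1) ^ 3 * SB.card := by
  set ball : Fin N → Finset (Fin N) := fun j =>
    Finset.univ.filter fun i : Fin N => dist (X i) (X j) ≤ 7 / 2 with hball
  have hsub : SL ⊆ SB.biUnion ball := by
    intro i hi
    have h := hSL i hi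
    push Not at h
    obtain ⟨j, hj, hg⟩ := h
    refine Finset.mem_biUnion.2 ⟨j, hSB j hg, ?_⟩
    simp only [hball, Finset.mem_filter, Finset.mem_univ, true_and]
    exact hj
  have hinj : Function.Injective X := by
    intro a b hab
    by_contra hne
    have := hsep a b hne
    rw [hab, dist_self] at this
    linarith
  have hballcard : ∀ j : Fin N, ((ball j).card : ℝ) ≤ (2 * (7 / 2) / δ + 1) ^ 3 := by
    intro j
    have hc : ((ball j).image X).card = (ball j).card := Finset.card_image_of_injective _ hinj
    have h := card_le_of_separated_of_dist_le ((ball j).image X) (X j) hδ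
      (by norm_num : (0 : ℝ) ≤ 7 / 2) ?_ ?_
    · rw [hc, finrank_euclideanSpace_fin] at h
      exact h
    · intro c hc'
      obtain ⟨i, hi, rfl⟩ := Finset.mem_image.1 hc'
      simp only [hball, Finset.mem_filter, Finset.mem_univ, true_and] at hi
      exact hi
    · intro c hc' d hd hcd
      obtain ⟨a, -, rfl⟩ := Finset.mem_image.1 hc'
      obtain ⟨b, -, rfl⟩ := Finset.mem_image.1 hd
      exact hsep a b fun hab => hcd (by rw [hab])
  calc (SL.card : ℝ)
      ≤ ((SB.biUnion ball).card : ℝ) := by exact_mod_cast Finset.card_le_card hsub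
    _ ≤ ∑ j ∈ SB, ((ball j).card : ℝ) := by exact_mod_cast Finset.card_biUnion_le
    _ ≤ ∑ j ∈ SB, (2 * (7 / 2) / δ + 1) ^ 3 := Finset.sum_le_sum fun j _ => hballcard j
    _ = (2 * (7 / 2) / δ + 1) ^ 3 * SB.card := by
        rw [Finset.sum_const, nsmul_eq_mul, mul_comm]

end RdvSplit

open RdvSplit in
/-- **The split glue** (crux-strategist decomposition of stmt-AtomisticToContinuum-15930):
`TwelveWithinOne → ThickThirteen → GapBeyondTwelve → RadialDefectsVanish`, at the selected scale
`a = 50/51`.  The three hypotheses are the children of the split, stated literally (the first is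
verbatim `SquareWellLayerCake.TwelveWithinOne`, stmt-AtomisticToContinuum-15808). [folklore] -/
theorem RadialDefectsVanish_of_subs
    (hK2 : ∀ x : (N : ℕ) → (Fin N → EuclideanSpace ℝ (Fin 3)),
      (∀ N, Literature.MathematicalPhysics.StatisticalMechanics.IsGroundState
        Literature.MathematicalPhysics.StatisticalMechanics.lennardJones (x N)) →
      Filter.Tendsto (fun N : ℕ => (Nat.card {i : Fin N // ¬ ((∀ j : Fin N, dist (x N i) (x N j) ≤ 11 / 10 →
        ∀ k : Fin N, k ≠ j → (55 : ℝ) / 57 ≤ dist (x N j) (x N k)) ∧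
        12 ≤ (Finset.univ.filter fun j : Fin N => j ≠ i ∧ dist (x N i) (x N j) ≤ 1).card)} : ℝ) / N)
        Filter.atTop (nhds 0))
    (hT : ∀ T : Finset (EuclideanSpace ℝ (Fin 3)), (∀ v ∈ T, (55 : ℝ) / 57 ≤ ‖v‖ ∧ ‖v‖ ≤ 1) →
      (∀ v ∈ T, ∀ w ∈ T, v ≠ w → (55 : ℝ) / 57 ≤ dist v w) → T.card ≤ 12)
    (hG : ∀ x : (N : ℕ) → (Fin N → EuclideanSpace ℝ (Fin 3)),
      (∀ N, Literature.MathematicalPhysics.StatisticalMechanics.IsGroundState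
        Literature.MathematicalPhysics.StatisticalMechanics.lennardJones (x N)) →
      ∀ θ : ℝ, 0 < θ → ∃ᶠ N in Filter.atTop, (Nat.card {i : Fin N //
        (∀ j : Fin N, dist (x N i) (x N j) ≤ 7 / 2 →
          (∀ k : Fin N, dist (x N j) (x N k) ≤ 11 / 10 → ∀ l : Fin N, l ≠ k → (55 : ℝ) / 57 ≤ dist (x N k) (x N l)) ∧
          (Finset.univ.filter fun k : Fin N => k ≠ j ∧ dist (x N j) (x N k) ≤ 1).card = 12) ∧
        ∃ j : Fin N, j ≠ i ∧ 1 < dist (x N i) (x N j) ∧ dist (x N i) (x N j) < 21 / 17} : ℝ) ≤ θ * N) :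
    Summit.AtomisticToContinuum.Crystallization.Theses.GappedShellCensus.RadialDefectsVanish := by
  intro x hx
  refine ⟨50 / 51, by norm_num, by norm_num, fun θ hθ => ?_⟩
  obtain ⟨δ₀, hδ₀, hsep⟩ := LennardJonesMinimalDistance_holds
  set K : ℝ := (2 * (7 / 2) / δ₀ + 1) ^ 3 with hK
  have hK1 : 1 ≤ K := by
    have h0 : (0 : ℝ) ≤ 2 * (7 / 2) / δ₀ := by positivity
    have h1 : (1 : ℝ) ≤ 2 * (7 / 2) / δ₀ + 1 := by linarith
    exact one_le_pow₀ h1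
  have hKpos : 0 < K := by linarith
  -- (1) eventually few non-PRE sites (child `TwelveWithinOne`)
  have h1 : ∀ᶠ N in Filter.atTop,
      ((Finset.univ.filter fun i : Fin N => ¬ ((∀ j : Fin N, dist (x N i) (x N j) ≤ 11 / 10 →
        ∀ k : Fin N, k ≠ j → (55 : ℝ) / 57 ≤ dist (x N j) (x N k)) ∧
        12 ≤ (Finset.univ.filter fun j : Fin N => j ≠ i ∧ dist (x N i) (x N j) ≤ 1).card)).card : ℝ) ≤
        θ / (2 * K) * N := by
    have hpos : (0 : ℝ) < θ / (2 * K) := by positivity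
    filter_upwards [(hK2 x hx).eventually (gt_mem_nhds hpos)] with N hN
    rw [Nat.card_eq_fintype_card, Fintype.card_subtype] at hN
    rcases Nat.eq_zero_or_pos N with hN0 | hNpos
    · subst hN0
      simp
    · have hNr : (0 : ℝ) < N := by exact_mod_cast hNpos
      exact ((div_lt_iff₀ hNr).1 hN).le
  -- (2) frequently few locally-twelve sites with an annulus neighbour (child `GapBeyondTwelve`)
  have h2 : ∃ᶠ N in Filter.atTop,
      ((Finset.univ.filter fun i : Fin N =>
        (∀ j : Fin N, dist (x N i) (x N j) ≤ 7 / 2 →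
          (∀ k : Fin N, dist (x N j) (x N k) ≤ 11 / 10 → ∀ l : Fin N, l ≠ k → (55 : ℝ) / 57 ≤ dist (x N k) (x N l)) ∧
          (Finset.univ.filter fun k : Fin N => k ≠ j ∧ dist (x N j) (x N k) ≤ 1).card = 12) ∧
        ∃ j : Fin N, j ≠ i ∧ 1 < dist (x N i) (x N j) ∧ dist (x N i) (x N j) < 21 / 17).card : ℝ) ≤
        θ / 2 * N := by
    refine (hG x hx (θ / 2) (by positivity)).mono fun N hN => ?_
    rw [Nat.card_eq_fintype_card, Fintype.card_subtype] at hN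
    exact hN
  -- (3) combine at a fixed (frequent) `N`
  refine (h2.and_eventually h1).mono ?_
  rintro N ⟨hA, hP⟩
  rw [Nat.card_eq_fintype_card, Fintype.card_subtype]
  have hsepN : ∀ i j : Fin N, i ≠ j → δ₀ ≤ dist (x N i) (x N j) := hsep N (x N) (hx N)
  -- the finsets of this `N`
  set SGT := Finset.univ.filter fun i : Fin N => ¬ ((Finset.univ.filter fun j : Fin N =>
      j ≠ i ∧ dist (x N i) (x N j) ≤ 50 / 51 * (1 + 1 / 50)).card = 12 ∧
      ∀ j : Fin N, j ≠ i → 50 / 51 * (1 - 1 / 50) ≤ dist (x N i) (x N j) ∧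
        (dist (x N i) (x N j) ≤ 50 / 51 * (1 + 1 / 50) ∨ 50 / 51 * (63 / 50) ≤ dist (x N i) (x N j))) with hSGT
  set SA := Finset.univ.filter fun i : Fin N =>
      (∀ j : Fin N, dist (x N i) (x N j) ≤ 7 / 2 →
        (∀ k : Fin N, dist (x N j) (x N k) ≤ 11 / 10 → ∀ l : Fin N, l ≠ k → (55 : ℝ) / 57 ≤ dist (x N k) (x N l)) ∧
        (Finset.univ.filter fun k : Fin N => k ≠ j ∧ dist (x N j) (x N k) ≤ 1).card = 12) ∧
      ∃ j : Fin N, j ≠ i ∧ 1 < dist (x N i) (x N j) ∧ dist (x N i) (x N j) < 21 / 17 with hSA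
  set SP := Finset.univ.filter fun i : Fin N => ¬ ((∀ j : Fin N, dist (x N i) (x N j) ≤ 11 / 10 →
      ∀ k : Fin N, k ≠ j → (55 : ℝ) / 57 ≤ dist (x N j) (x N k)) ∧
      12 ≤ (Finset.univ.filter fun j : Fin N => j ≠ i ∧ dist (x N i) (x N j) ≤ 1).card) with hSP
  set SL := Finset.univ.filter fun i : Fin N => ¬ ∀ j : Fin N, dist (x N i) (x N j) ≤ 7 / 2 →
      ((∀ k : Fin N, dist (x N j) (x N k) ≤ 11 / 10 → ∀ l : Fin N, l ≠ k → (55 : ℝ) / 57 ≤ dist (x N k) (x N l)) ∧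
        (Finset.univ.filter fun k : Fin N => k ≠ j ∧ dist (x N j) (x N k) ≤ 1).card = 12) with hSL
  set SB := Finset.univ.filter fun j : Fin N => ¬ ((∀ k : Fin N, dist (x N j) (x N k) ≤ 11 / 10 →
      ∀ l : Fin N, l ≠ k → (55 : ℝ) / 57 ≤ dist (x N k) (x N l)) ∧
      (Finset.univ.filter fun k : Fin N => k ≠ j ∧ dist (x N j) (x N k) ≤ 1).card = 12) with hSB
  -- (a) not gapped-twelve ⇒ not locally twelve, or locally twelve with an annulus neighbour
  have hGT : (SGT.card : ℝ) ≤ SL.card + SA.card := by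
    have hsub : SGT ⊆ SL ∪ SA := by
      intro i hi
      rw [hSGT, Finset.mem_filter] at hi
      rw [Finset.mem_union, hSL, hSA, Finset.mem_filter, Finset.mem_filter]
      by_cases hL : ∀ j : Fin N, dist (x N i) (x N j) ≤ 7 / 2 →
          ((∀ k : Fin N, dist (x N j) (x N k) ≤ 11 / 10 → ∀ l : Fin N, l ≠ k → (55 : ℝ) / 57 ≤ dist (x N k) (x N l)) ∧
            (Finset.univ.filter fun k : Fin N => k ≠ j ∧ dist (x N j) (x N k) ≤ 1).card = 12)
      · right
        refine ⟨Finset.mem_univ _, hL, ?_⟩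
        by_contra hAnn
        have hGi := hL i (by rw [dist_self]; norm_num)
        exact hi.2 (gappedTwelve_of_twelve (x N) hGi.1 hGi.2 hAnn)
      · left
        exact ⟨Finset.mem_univ _, hL⟩
    exact_mod_cast (Finset.card_le_card hsub).trans (Finset.card_union_le _ _)
  -- (b) spoiled sites are few: packing count around the non-twelve sites
  have hLoc : (SL.card : ℝ) ≤ K * SB.card := by
    refine card_le_mul_card_of_local (x N)
      (fun j : Fin N => (∀ k : Fin N, dist (x N j) (x N k) ≤ 11 / 10 →
          ∀ l : Fin N, l ≠ k → (55 : ℝ) / 57 ≤ dist (x N k) (x N l)) ∧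
        (Finset.univ.filter fun k : Fin N => k ≠ j ∧ dist (x N j) (x N k) ≤ 1).card = 12)
      hδ₀ hsepN SL SB (fun i hi => ?_) (fun j hj => ?_)
    · rw [hSL, Finset.mem_filter] at hi
      exact hi.2
    · rw [hSB, Finset.mem_filter]
      exact ⟨Finset.mem_univ _, hj⟩
  -- (c) non-twelve sites are non-PRE sites (thick thirteen)
  have hGood : (SB.card : ℝ) ≤ SP.card := by
    have hsub : SB ⊆ SP := by
      intro j hj
      rw [hSB, Finset.mem_filter] at hj
      rw [hSP, Finset.mem_filter]
      refine ⟨Finset.mem_univ _, fun hp => hj.2 ⟨hp.1, ?_⟩⟩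
      exact le_antisymm (card_bond_le_twelve hT (x N) hp.1) hp.2
    exact_mod_cast Finset.card_le_card hsub
  have hKθ : K * (θ / (2 * K) * N) = θ / 2 * N := by
    field_simp
  calc (SGT.card : ℝ) ≤ SL.card + SA.card := hGT
    _ ≤ K * SB.card + θ / 2 * N := add_le_add hLoc hA
    _ ≤ K * SP.card + θ / 2 * N := by gcongr
    _ ≤ K * (θ / (2 * K) * N) + θ / 2 * N := by gcongr
    _ = θ * N := by rw [hKθ]; ring

namespace RdvSplit

/-- **Thick thirteen spheres, modulo Tammes-13** (the split's geometric child `ThickThirteen`, stated literally):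
if every set of unit vectors of `ℝ³` with pairwise distances `≥ 0.957` has at most twelve elements
(`musinTarasov2012_tammes_thirteen`, Musin–Tarasov 2012 Thm 1), then at most twelve points of `ℝ³` have norms in
`[55/57, 1]` and mutual distances `≥ 55/57`: the radial projections `‖v‖⁻¹ • v` are unit vectors with pairwise inner
product `≤ 1 − (55/57)²/2` (`TwelveWithinOne.Negative.inner_normalized_le`), hence pairwise distance
`≥ 55/57 > 0.957`, and the projection is injective on the set. [cite: MusinTarasov2012, Theorem 1] -/
theorem stub_thickThirteen_of_tammes (hMT : musinTarasov2012_tammes_thirteen) :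
    ∀ T : Finset (EuclideanSpace ℝ (Fin 3)), (∀ v ∈ T, (55 : ℝ) / 57 ≤ ‖v‖ ∧ ‖v‖ ≤ 1) →
      (∀ v ∈ T, ∀ w ∈ T, v ≠ w → (55 : ℝ) / 57 ≤ dist v w) → T.card ≤ 12 := by
  intro T hN hD
  set f : EuclideanSpace ℝ (Fin 3) → EuclideanSpace ℝ (Fin 3) := fun v => ‖v‖⁻¹ • v with hf
  have hinner : ∀ v ∈ T, ∀ w ∈ T, v ≠ w → ⟪f v, f w⟫ ≤ 1 - ((55 : ℝ) / 57) ^ 2 / 2 := by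
    intro v hv w hw hvw
    have hvw' : (55 : ℝ) / 57 ≤ ‖v - w‖ := by
      rw [← dist_eq_norm]
      exact hD v hv w hw hvw
    exact TwelveWithinOne.Negative.inner_normalized_le (hN v hv).1 (hN v hv).2 (hN w hw).1 (hN w hw).2 hvw'
  have hnorm : ∀ v ∈ T, ‖f v‖ = 1 := by
    intro v hv
    have h0 : 0 < ‖v‖ := by linarith [(hN v hv).1]
    simp only [hf, norm_smul, norm_inv, norm_norm, inv_mul_cancel₀ h0.ne']
  have hinj : Set.InjOn f (T : Set (EuclideanSpace ℝ (Fin 3))) := by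
    intro v hv w hw hfvw
    by_contra hne
    have h1 := hinner v hv w hw hne
    rw [hfvw, real_inner_self_eq_norm_sq, hnorm w hw] at h1
    norm_num at h1
  have hcard : (T.image f).card = T.card := Finset.card_image_of_injOn hinj
  rw [← hcard]
  refine hMT _ ?_ ?_
  · intro u hu
    obtain ⟨v, hv, rfl⟩ := Finset.mem_image.1 hu
    exact hnorm v hv
  · intro u hu u' hu' huu'
    obtain ⟨v, hv, rfl⟩ := Finset.mem_image.1 hu
    obtain ⟨w, hw, rfl⟩ := Finset.mem_image.1 hu'
    have hne : v ≠ w := fun h => huu' (by rw [h])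
    have hin := hinner v hv w hw hne
    have hsq : dist (f v) (f w) ^ 2 = 2 - 2 * ⟪f v, f w⟫ := by
      rw [dist_eq_norm, norm_sub_sq_real, hnorm v hv, hnorm w hw]; ring
    nlinarith [dist_nonneg (x := f v) (y := f w)]

end RdvSplit

open RdvSplit in
/-- **The crux from the Tammes-13 named fact and the two energetic children** (`TwelveWithinOne` =
stmt-AtomisticToContinuum-15808 and `GapBeyondTwelve`, both stated literally): the honest dependency left by the split —
one named fact of discrete geometry (Musin–Tarasov 2012) and two open statements about true Lennard-Jones ground states.
[cite: MusinTarasov2012, Theorem 1] -/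
theorem radialDefectsVanish_of_tammes (hMT : musinTarasov2012_tammes_thirteen)
    (hK2 : ∀ x : (N : ℕ) → (Fin N → EuclideanSpace ℝ (Fin 3)),
      (∀ N, Literature.MathematicalPhysics.StatisticalMechanics.IsGroundState
        Literature.MathematicalPhysics.StatisticalMechanics.lennardJones (x N)) →
      Filter.Tendsto (fun N : ℕ => (Nat.card {i : Fin N // ¬ ((∀ j : Fin N, dist (x N i) (x N j) ≤ 11 / 10 →
        ∀ k : Fin N, k ≠ j → (55 : ℝ) / 57 ≤ dist (x N j) (x N k)) ∧
        12 ≤ (Finset.univ.filter fun j : Fin N => j ≠ i ∧ dist (x N i) (x N j) ≤ 1).card)} : ℝ) / N)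
        Filter.atTop (nhds 0))
    (hG : ∀ x : (N : ℕ) → (Fin N → EuclideanSpace ℝ (Fin 3)),
      (∀ N, Literature.MathematicalPhysics.StatisticalMechanics.IsGroundState
        Literature.MathematicalPhysics.StatisticalMechanics.lennardJones (x N)) →
      ∀ θ : ℝ, 0 < θ → ∃ᶠ N in Filter.atTop, (Nat.card {i : Fin N //
        (∀ j : Fin N, dist (x N i) (x N j) ≤ 7 / 2 →
          (∀ k : Fin N, dist (x N j) (x N k) ≤ 11 / 10 → ∀ l : Fin N, l ≠ k → (55 : ℝ) / 57 ≤ dist (x N k) (x N l)) ∧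
          (Finset.univ.filter fun k : Fin N => k ≠ j ∧ dist (x N j) (x N k) ≤ 1).card = 12) ∧
        ∃ j : Fin N, j ≠ i ∧ 1 < dist (x N i) (x N j) ∧ dist (x N i) (x N j) < 21 / 17} : ℝ) ≤ θ * N) :
    Summit.AtomisticToContinuum.Crystallization.Theses.GappedShellCensus.RadialDefectsVanish :=
  RadialDefectsVanish_of_subs hK2 (stub_thickThirteen_of_tammes hMT) hG

end Summit.AtomisticToContinuum.Crystallization.Theorems

end
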